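import Mathlib

/-!
# Crux `HilbertIntegralOverconvergentIsCongruence` (stmt-Langlands-8485), line `Sketch-ideate-r1-k1`:
# stub S2 — the archimedean coefficient bound for multivariable power series

The archimedean input of the dimension-free algebraization engine.  For a weight `wt : (σ →₀ ℕ) →+ ℕ`
and `0 ≤ t`, the weighted `ℓ¹` size of `φ : MvPowerSeries σ ℂ` is `W_t(φ) = Σ_ν ‖φ_ν‖ t^{wt ν}`.
Taking the submultiplicativity `W_t(φ ψ) ≤ W_t(φ) W_t(ψ)` (stub S1) as a hypothesis, we prove:

* `mvArch_norm_coeff_mul_pow_le` — the coefficient bound `‖φ_ν‖ t^{wt ν} ≤ W_t(φ)`;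
* `mvArch_weighted_pow` — `W_t(φ^m) ≤ W_t(φ)^m`;
* `stub_mvArchBound` (registered stub S2) — at `t₀ = e^{-η} ∈ (0,1)`, if `W_{t₀}(f) ≤ B_f` and
  `W_{t₀}(x) ≤ B_x` with `B_x ≥ 1`, then for `j ≤ D` every coefficient of `f · x^j` has norm
  `≤ B_f · B_x^D · e^{η wt ν}`.

Theorems only, no `sorry`.
-/

set_option linter.dupNamespace false

noncomputable section

namespace Summit.Langlands.Langlands.Theorems.HilbertIntegralOverconvergentIsCongruence

/-! ### Weighted `ℓ¹` sizes of multivariable complex power series -/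

/-- Coefficient bound from a finite weighted `ℓ¹` size (multivariable):
`‖φ_ν‖ t^{wt ν} ≤ Σ_n ‖φ_n‖ t^{wt n}`. [folklore] -/
theorem mvArch_norm_coeff_mul_pow_le {σ : Type*} (wt : (σ →₀ ℕ) →+ ℕ) (φ : MvPowerSeries σ ℂ)
    (t : ℝ) (ht : 0 ≤ t)
    (hφ : Summable fun n : σ →₀ ℕ ↦ ‖MvPowerSeries.coeff n φ‖ * t ^ wt n) (ν : σ →₀ ℕ) :
    ‖MvPowerSeries.coeff ν φ‖ * t ^ wt ν ≤ ∑' n : σ →₀ ℕ, ‖MvPowerSeries.coeff n φ‖ * t ^ wt n :=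
  hφ.le_tsum ν fun m _ ↦ by positivity

/-- Weighted `ℓ¹` sizes of POWERS (multivariable): if the size of `φ` is finite then so is that of
`φ ^ m`, and it is at most the `m`-th power of the size of `φ` (iterate the product rule `hS1`,
stub S1; the case `m = 0` is the series `1`, of size `t^{wt 0} = 1`). [folklore] -/
theorem mvArch_weighted_pow {σ : Type*} (wt : (σ →₀ ℕ) →+ ℕ)
    (hS1 : ∀ (φ ψ : MvPowerSeries σ ℂ) (t : ℝ), 0 ≤ t →
      (Summable fun n : σ →₀ ℕ ↦ ‖MvPowerSeries.coeff n φ‖ * t ^ wt n) →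
      (Summable fun n : σ →₀ ℕ ↦ ‖MvPowerSeries.coeff n ψ‖ * t ^ wt n) →
      Summable (fun n : σ →₀ ℕ ↦ ‖MvPowerSeries.coeff n (φ * ψ)‖ * t ^ wt n) ∧
        ∑' n : σ →₀ ℕ, ‖MvPowerSeries.coeff n (φ * ψ)‖ * t ^ wt n ≤
          (∑' n : σ →₀ ℕ, ‖MvPowerSeries.coeff n φ‖ * t ^ wt n) *
            ∑' n : σ →₀ ℕ, ‖MvPowerSeries.coeff n ψ‖ * t ^ wt n)
    (φ : MvPowerSeries σ ℂ) (t : ℝ) (ht : 0 ≤ t)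
    (hφ : Summable fun n : σ →₀ ℕ ↦ ‖MvPowerSeries.coeff n φ‖ * t ^ wt n) (m : ℕ) :
    Summable (fun n : σ →₀ ℕ ↦ ‖MvPowerSeries.coeff n (φ ^ m)‖ * t ^ wt n) ∧
      ∑' n : σ →₀ ℕ, ‖MvPowerSeries.coeff n (φ ^ m)‖ * t ^ wt n ≤
        (∑' n : σ →₀ ℕ, ‖MvPowerSeries.coeff n φ‖ * t ^ wt n) ^ m := by
  classical
  induction m with
  | zero =>
    have hfun : (fun n : σ →₀ ℕ ↦ ‖MvPowerSeries.coeff n ((φ : MvPowerSeries σ ℂ) ^ 0)‖ * t ^ wt n) =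
        fun n : σ →₀ ℕ ↦ if n = 0 then (1 : ℝ) else 0 := by
      funext n
      rw [pow_zero, MvPowerSeries.coeff_one]
      split_ifs with h
      · subst h; simp
      · simp
    rw [hfun]
    refine ⟨summable_of_ne_finset_zero (s := {0}) (fun n hn ↦ ?_), ?_⟩
    · rw [Finset.mem_singleton] at hn
      simp [hn]
    · rw [tsum_eq_single 0 (fun n hn ↦ if_neg hn), if_pos rfl, pow_zero]
  | succ m ih =>
    obtain ⟨hs, hle⟩ := ih
    obtain ⟨hs', hle'⟩ := hS1 (φ ^ m) φ t ht hs hφ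
    refine ⟨by simpa [pow_succ] using hs', ?_⟩
    rw [pow_succ, pow_succ]
    refine hle'.trans ?_
    have h0 : 0 ≤ ∑' n : σ →₀ ℕ, ‖MvPowerSeries.coeff n φ‖ * t ^ wt n :=
      tsum_nonneg fun n ↦ by positivity
    exact mul_le_mul_of_nonneg_right hle h0

/-! ### The archimedean bound (registered stub S2) -/

/-- **stub S2 — `stub_mvArchBound` (S/M; R8a without monomials).**  With S1 as hypothesis `hS1`: at
`t₀ = e^{-η} ∈ (0,1)`, if `W_{t₀}(f) ≤ B_f` and `W_{t₀}(x) ≤ B_x` (`B_x ≥ 1`) then for `j ≤ D` every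
coefficient of `f · x^j` has norm `≤ B_f · B_x^D · e^{η wt ν}` (powers by induction on S1, then
`‖φ_ν‖ t₀^{wt ν} ≤ W_{t₀}(φ)`). [folklore] -/
theorem stub_mvArchBound {σ : Type*} (wt : (σ →₀ ℕ) →+ ℕ)
    (hS1 : ∀ (φ ψ : MvPowerSeries σ ℂ) (t : ℝ), 0 ≤ t →
      (Summable fun n : σ →₀ ℕ ↦ ‖MvPowerSeries.coeff n φ‖ * t ^ wt n) →
      (Summable fun n : σ →₀ ℕ ↦ ‖MvPowerSeries.coeff n ψ‖ * t ^ wt n) →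
      Summable (fun n : σ →₀ ℕ ↦ ‖MvPowerSeries.coeff n (φ * ψ)‖ * t ^ wt n) ∧
        ∑' n : σ →₀ ℕ, ‖MvPowerSeries.coeff n (φ * ψ)‖ * t ^ wt n ≤
          (∑' n : σ →₀ ℕ, ‖MvPowerSeries.coeff n φ‖ * t ^ wt n) *
            ∑' n : σ →₀ ℕ, ‖MvPowerSeries.coeff n ψ‖ * t ^ wt n)
    (t₀ η : ℝ) (ht₀0 : 0 < t₀) (_ht₀1 : t₀ < 1) (ht₀η : t₀ = Real.exp (-η))
    (Bf Bx : ℝ) (hBx : 1 ≤ Bx) (f x : MvPowerSeries σ ℂ)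
    (hf : Summable fun n : σ →₀ ℕ ↦ ‖MvPowerSeries.coeff n f‖ * t₀ ^ wt n)
    (hWf : ∑' n : σ →₀ ℕ, ‖MvPowerSeries.coeff n f‖ * t₀ ^ wt n ≤ Bf)
    (hx : Summable fun n : σ →₀ ℕ ↦ ‖MvPowerSeries.coeff n x‖ * t₀ ^ wt n)
    (hWx : ∑' n : σ →₀ ℕ, ‖MvPowerSeries.coeff n x‖ * t₀ ^ wt n ≤ Bx)
    (j D : ℕ) (hj : j ≤ D) (ν : σ →₀ ℕ) :
    ‖MvPowerSeries.coeff ν (f * x ^ j)‖ ≤ Bf * Bx ^ D * Real.exp (η * wt ν) := by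
  have hBx0 : 0 ≤ Bx := zero_le_one.trans hBx
  have hBf0 : 0 ≤ Bf := (tsum_nonneg fun n ↦ by positivity).trans hWf
  -- the weighted size of `x ^ j` is at most `Bx ^ j ≤ Bx ^ D`
  obtain ⟨hpx, hlex⟩ := mvArch_weighted_pow wt hS1 x t₀ ht₀0.le hx j
  have hlex' : ∑' n : σ →₀ ℕ, ‖MvPowerSeries.coeff n (x ^ j)‖ * t₀ ^ wt n ≤ Bx ^ D := by
    refine hlex.trans ?_
    exact (pow_le_pow_left₀ (tsum_nonneg fun n ↦ by positivity) hWx j).trans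
      (pow_le_pow_right₀ hBx hj)
  -- the weighted size of `f * x ^ j` is at most `Bf * Bx ^ D`
  obtain ⟨hs, hle⟩ := hS1 f (x ^ j) t₀ ht₀0.le hf hpx
  have hle' : ∑' n : σ →₀ ℕ, ‖MvPowerSeries.coeff n (f * x ^ j)‖ * t₀ ^ wt n ≤ Bf * Bx ^ D := by
    refine hle.trans ?_
    exact mul_le_mul hWf hlex' (tsum_nonneg fun n ↦ by positivity) hBf0
  -- from the weighted size to the coefficient
  have h1 := (mvArch_norm_coeff_mul_pow_le wt (f * x ^ j) t₀ ht₀0.le hs ν).trans hle'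
  have ht : t₀ ^ wt ν * Real.exp (η * wt ν) = 1 := by
    rw [ht₀η, ← Real.exp_nat_mul, ← Real.exp_add]
    convert Real.exp_zero using 2
    ring
  have hexp : 0 < Real.exp (η * wt ν) := Real.exp_pos _
  calc ‖MvPowerSeries.coeff ν (f * x ^ j)‖
        = ‖MvPowerSeries.coeff ν (f * x ^ j)‖ * t₀ ^ wt ν * Real.exp (η * wt ν) := by
        rw [mul_assoc, ht, mul_one]
    _ ≤ Bf * Bx ^ D * Real.exp (η * wt ν) := mul_le_mul_of_nonneg_right h1 hexp.le

end Summit.Langlands.Langlands.Theorems.HilbertIntegralOverconvergentIsCongruence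

end
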